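import Literature.Computability.Cryptography.RegevCVPOracleErrFn
import HarnessLib

/-!
# Regev 2009, Lemma 3.14 / 3.3: the Gaussian average of the subroutine's error is the weighted failure

Topic `Computability/Cryptography` (family `pqc`), grouping namespace `Regev2009.CVPOracle`; sequel of
`RegevCVPOracleErrFn.lean` (BBBV's tidy-block error `TidyBlockFn.errFn` of the `CVP` family `R` for the
ideal answer function at the query string of in-range data `c` is at most `failProb R I ρ k y c`). In the
oracle substitution for Regev's sampler (Lemma 3.14 run with the procedure of Lemma 3.4 in its two oracle
slots) the substitution error is `2√(Σ_x p(x) · errFn(query of x))` per call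
(`TidyBlockFn.l2Norm_stage_tidy_sub_le` with `TidyBlockFn.sum_mul_placedQueryWeight_sum_smul`), the sum
over the points `x` of the box with their Gaussian weights `p(x) = (ρ(x)/Z)²` and the query of `x` the
string of its residue data `c(x)`. This file turns that finite average into the quantity A_q14
(`regev2009_lemma_3_14_stepFamily`) is stated with:

* general-width forms of the bridge (`errFn_le_one_of_ofFn_eq`, `errFn_answerFn_le_failProb_of_ofFn_eq`):
  the tidy register of the machine has a FIXED query width `K`, its content `xq` satisfying
  `List.ofFn xq = query I ρ k y c` — no cast on the width is needed by the caller;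
* **`dataLaw`** — the law `w` of the data `c(x)`, `x ∼ p` on a finite set (a `PMF` on `QData n`), with its
  expectation formula `tsum_dataLaw_mul` and its mass formula `dataLaw_toOuterMeasure_apply`;
* **`sum_mul_errFn_le_weightedFail_add`** — `Σ_x p(x) errFn(x) ≤ weightedFail(R, …, d, w) + w{¬Admissible_d}`
  (in `ℝ`): the Gaussian average of the subroutine's error is at most the weighted failure on admissible
  data — what A_cvp / A_q14 charge to `R` — plus the mass of inadmissible data, which the caller bounds by
  a Gaussian tail (Regev 2009, Lemma 2.5) and puts into `ν'`.

Everything is proved; definitions have bodies; no named fact is introduced.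

## References

* O. Regev, *On lattices, learning with errors, random linear codes, and cryptography*, J. ACM 56
  (2009), art. 34; author's version arXiv:2401.03703: Lemma 3.3 (proof), Lemma 3.14 (proof), Lemma 2.5
  [Regev2009].
* C. H. Bennett, E. Bernstein, G. Brassard, U. Vazirani, *Strengths and weaknesses of quantum
  computing*, SIAM J. Comput. 26 (1997) 1510–1523, Def. 4.12, Thm. 4.14, Thm. 3.3
  [BennettBernsteinBrassardVazirani1997].
-/

noncomputable section

namespace Literature.Computability.Cryptography

open _root_.Computability Literature.Computability.Complexity Literature.Computability.QuantumComplexity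
  Literature.Algebra.EuclideanLattices Finset

open scoped ENNReal

namespace Regev2009

namespace CVPOracle

/-! ### General-width forms of the bridge -/

/-- The error of the subroutine is at most `1`, at any query width. [folklore] -/
theorem errFn_le_one_of_width (R : UniformQCircuitFamily) {K ℓ : ℕ} (fn : QReg K → QReg ℓ) (xq : QReg K) :
    TidyBlockFn.errFn fn (R.family.circ K) xq ≤ 1 := by
  obtain ⟨x, hx⟩ : ∃ x : List Bool, List.ofFn xq = x := ⟨_, rfl⟩
  have hK : K = x.length := by rw [← hx, List.length_ofFn]
  subst hK
  have hq : xq = x.get := List.ofFn_injective (hx.trans (List.ofFn_get x).symm)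
  rw [hq]
  exact UniformQCircuitFamily.errFn_le_one R x fn

/-- **The bridge at a fixed query width**: if the query register of width `K` holds the query string of
in-range data `c` (`List.ofFn xq = query I ρ k y c`), the tidy-block error of `R.circ K` for the ideal
answer function of width `ℓ ≤ |answerTable c|` is at most `failProb R I ρ k y c`.
[cite: Regev2009, Lemma 3.3 (proof)] [cite: BennettBernsteinBrassardVazirani1997, Def. 4.12, Thm. 4.14] -/
theorem errFn_answerFn_le_failProb_of_ofFn_eq (R : UniformQCircuitFamily) (I : LatticeInstance) (ρ : ℚ) (k : ℕ)
    (y : List Bool) {c : QData I.n} (hc : InRange c) {K ℓ : ℕ} {xq : QReg K}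
    (hx : List.ofFn xq = query I ρ k y c) (hℓ : ℓ ≤ (answerTable I c).length) :
    TidyBlockFn.errFn (answerFn I ρ k y K ℓ) (R.family.circ K) xq ≤ failProb R I ρ k y c := by
  obtain ⟨x, hx'⟩ : ∃ x : List Bool, query I ρ k y c = x := ⟨_, rfl⟩
  rw [hx'] at hx
  have hK : K = x.length := by rw [← hx, List.length_ofFn]
  subst hK
  have hq : xq = x.get := List.ofFn_injective (hx.trans (List.ofFn_get x).symm)
  rw [hq]
  subst hx'
  exact errFn_answerFn_le_failProb R I ρ k y hc hℓ

/-! ### The law of the query data -/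

section Law

variable {ι : Type*} {n : ℕ}

/-- The fibre weight of the datum `c`: the total weight of the points with data `c`. [folklore] -/
def fibreWeight (T : Finset ι) (p : ι → ℝ) (cOf : ι → QData n) (c : QData n) : ℝ :=
  ∑ x ∈ T.filter (fun x => cOf x = c), p x

/-- Fibre weights are nonnegative for nonnegative weights. [folklore] -/
theorem fibreWeight_nonneg {T : Finset ι} {p : ι → ℝ} (hp0 : ∀ x ∈ T, 0 ≤ p x) (cOf : ι → QData n) (c : QData n) :
    0 ≤ fibreWeight T p cOf c :=
  sum_nonneg fun x hx => hp0 x (mem_filter.1 hx).1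

/-- Off the image the fibre weight vanishes. [folklore] -/
theorem fibreWeight_eq_zero_of_notMem {T : Finset ι} (p : ι → ℝ) {cOf : ι → QData n} {c : QData n}
    (hc : c ∉ T.image cOf) : fibreWeight T p cOf c = 0 :=
  sum_eq_zero fun x hx => absurd (mem_image.2 ⟨x, (mem_filter.1 hx).1, (mem_filter.1 hx).2⟩) hc

/-- **Summing a function of the datum against the fibre weights is summing it against the weights.**
[folklore] -/
theorem sum_fibreWeight_mul (T : Finset ι) (p : ι → ℝ) (cOf : ι → QData n) (G : QData n → ℝ) :
    ∑ c ∈ T.image cOf, fibreWeight T p cOf c * G c = ∑ x ∈ T, p x * G (cOf x) := by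
  simp_rw [fibreWeight, sum_mul]
  rw [← sum_fiberwise_of_maps_to (t := T.image cOf) (g := cOf) (f := fun x => p x * G (cOf x))
    fun x hx => mem_image_of_mem cOf hx]
  refine sum_congr rfl fun c _ => sum_congr rfl fun x hx => ?_
  rw [(mem_filter.1 hx).2]

/-- The fibre weights sum to the total weight. [folklore] -/
theorem sum_fibreWeight (T : Finset ι) (p : ι → ℝ) (cOf : ι → QData n) :
    ∑ c ∈ T.image cOf, fibreWeight T p cOf c = ∑ x ∈ T, p x := by
  have h := sum_fibreWeight_mul T p cOf (fun _ => 1)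
  simp only [mul_one] at h
  exact h

/-- **The law of the data** `c(x)`, `x ∼ p` on the finite set `T` (weights `p ≥ 0` summing to `1`): a
probability mass function on `QData n`. [cite: Regev2009, Lemma 3.14 (proof: the distribution of `x mod P`)] -/
def dataLaw (T : Finset ι) (p : ι → ℝ) (hp0 : ∀ x ∈ T, 0 ≤ p x) (hp1 : ∑ x ∈ T, p x = 1) (cOf : ι → QData n) :
    PMF (QData n) :=
  PMF.ofFinset (fun c => ENNReal.ofReal (fibreWeight T p cOf c)) (T.image cOf)
    (by rw [← ENNReal.ofReal_sum_of_nonneg fun c _ => fibreWeight_nonneg hp0 cOf c, sum_fibreWeight, hp1,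
      ENNReal.ofReal_one])
    (fun c hc => by rw [fibreWeight_eq_zero_of_notMem p hc, ENNReal.ofReal_zero])

/-- The mass of a datum under the law of the data. [folklore] -/
theorem dataLaw_apply (T : Finset ι) (p : ι → ℝ) (hp0 : ∀ x ∈ T, 0 ≤ p x) (hp1 : ∑ x ∈ T, p x = 1)
    (cOf : ι → QData n) (c : QData n) : dataLaw T p hp0 hp1 cOf c = ENNReal.ofReal (fibreWeight T p cOf c) :=
  PMF.ofFinset_apply _ _ c

/-- **Expectation under the law of the data**: `Σ' c, w(c) · G(c) = Σ_x p(x) · G(c(x))` for `G ≥ 0`.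
[folklore] -/
theorem tsum_dataLaw_mul (T : Finset ι) (p : ι → ℝ) (hp0 : ∀ x ∈ T, 0 ≤ p x) (hp1 : ∑ x ∈ T, p x = 1)
    (cOf : ι → QData n) {G : QData n → ℝ} (hG : ∀ c, 0 ≤ G c) :
    ∑' c, dataLaw T p hp0 hp1 cOf c * ENNReal.ofReal (G c) = ENNReal.ofReal (∑ x ∈ T, p x * G (cOf x)) := by
  rw [tsum_eq_sum (s := T.image cOf) fun c hc => by
    rw [dataLaw_apply, fibreWeight_eq_zero_of_notMem p hc, ENNReal.ofReal_zero, zero_mul]]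
  simp_rw [dataLaw_apply]
  rw [← sum_fibreWeight_mul, ENNReal.ofReal_sum_of_nonneg fun c _ => mul_nonneg (fibreWeight_nonneg hp0 cOf c) (hG c)]
  exact sum_congr rfl fun c _ => (ENNReal.ofReal_mul (fibreWeight_nonneg hp0 cOf c)).symm

open scoped Classical in
/-- **The mass of a set of data**: the total weight of the points whose datum lies in it. [folklore] -/
theorem dataLaw_toOuterMeasure_apply (T : Finset ι) (p : ι → ℝ) (hp0 : ∀ x ∈ T, 0 ≤ p x) (hp1 : ∑ x ∈ T, p x = 1)
    (cOf : ι → QData n) (E : Set (QData n)) :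
    (dataLaw T p hp0 hp1 cOf).toOuterMeasure E = ENNReal.ofReal (∑ x ∈ T.filter (fun x => cOf x ∈ E), p x) := by
  rw [PMF.toOuterMeasure_apply]
  have h : ∀ c, E.indicator (dataLaw T p hp0 hp1 cOf) c =
      dataLaw T p hp0 hp1 cOf c * ENNReal.ofReal (if c ∈ E then 1 else 0) := fun c => by
    by_cases hc : c ∈ E
    · rw [Set.indicator_of_mem hc, if_pos hc, ENNReal.ofReal_one, mul_one]
    · rw [Set.indicator_of_notMem hc, if_neg hc, ENNReal.ofReal_zero, mul_zero]
  simp_rw [h]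
  rw [tsum_dataLaw_mul T p hp0 hp1 cOf fun c => by positivity, sum_filter]
  congr 1
  exact sum_congr rfl fun x _ => by split_ifs <;> simp

end Law

/-! ### The average error is the weighted failure plus the inadmissible mass -/

/-- **The Gaussian average of the subroutine's error is at most the weighted failure plus the mass of
inadmissible data.** Points `x` of a finite set with weights `p ≥ 0` summing to `1`, data `c(x)` in range
with answer tables of length `≥ ℓ`, query registers of width `K` holding the query strings of the data:
`Σ_x p(x) · errFn(x) ≤ weightedFail(R, I, ρ, k, y, d, w) + w{c | ¬ Admissible_d c}`, `w` the law of the data.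
[cite: Regev2009, Lemma 3.14 (proof) and Lemma 3.3 (proof)] [cite: BennettBernsteinBrassardVazirani1997, Thm. 3.3 with Thm. 4.14] -/
theorem sum_mul_errFn_le_weightedFail_add (R : UniformQCircuitFamily) (I : LatticeInstance) (ρ : ℚ) (k : ℕ)
    (y : List Bool) (d : ℝ) {ι : Type*} (T : Finset ι) (p : ι → ℝ) (hp0 : ∀ x ∈ T, 0 ≤ p x)
    (hp1 : ∑ x ∈ T, p x = 1) (cOf : ι → QData I.n) {K ℓ : ℕ} (xq : ι → QReg K)
    (hx : ∀ x ∈ T, List.ofFn (xq x) = query I ρ k y (cOf x)) (hc : ∀ x ∈ T, InRange (cOf x))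
    (hℓ : ∀ x ∈ T, ℓ ≤ (answerTable I (cOf x)).length) :
    ∑ x ∈ T, p x * TidyBlockFn.errFn (answerFn I ρ k y K ℓ) (R.family.circ K) (xq x) ≤
      (weightedFail R I ρ k y d (dataLaw T p hp0 hp1 cOf)).toReal +
        ((dataLaw T p hp0 hp1 cOf).toOuterMeasure {c | ¬ Admissible I d c}).toReal := by
  set w := dataLaw T p hp0 hp1 cOf with hw
  -- pointwise: the error is at most the failure probability of the datum
  have h1 : ∑ x ∈ T, p x * TidyBlockFn.errFn (answerFn I ρ k y K ℓ) (R.family.circ K) (xq x) ≤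
      ∑ x ∈ T, p x * failProb R I ρ k y (cOf x) :=
    sum_le_sum fun x hxT => mul_le_mul_of_nonneg_left
      (errFn_answerFn_le_failProb_of_ofFn_eq R I ρ k y (hc x hxT) (hx x hxT) (hℓ x hxT)) (hp0 x hxT)
  -- the average of the failure probability under the law of the data
  have h2 : ENNReal.ofReal (∑ x ∈ T, p x * failProb R I ρ k y (cOf x)) ≤
      weightedFail R I ρ k y d w + w.toOuterMeasure {c | ¬ Admissible I d c} := by
    rw [← tsum_dataLaw_mul T p hp0 hp1 cOf (failProb_nonneg R I ρ k y)]
    exact tsum_mul_failProb_le_weightedFail_add R I ρ k y d w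
  have hfin1 : weightedFail R I ρ k y d w ≠ ∞ := ne_top_of_le_ne_top ENNReal.one_ne_top (weightedFail_le_one R I ρ k y d w)
  have hfin2 : w.toOuterMeasure {c | ¬ Admissible I d c} ≠ ∞ :=
    ne_top_of_le_ne_top ENNReal.one_ne_top (by rw [PMF.toOuterMeasure_apply]; exact
      (ENNReal.tsum_le_tsum fun c => Set.indicator_le_self _ _ c).trans (le_of_eq w.tsum_coe))
  have h3 : ∑ x ∈ T, p x * failProb R I ρ k y (cOf x) ≤
      (weightedFail R I ρ k y d w).toReal + (w.toOuterMeasure {c | ¬ Admissible I d c}).toReal := by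
    rw [← ENNReal.toReal_add hfin1 hfin2]
    exact (ENNReal.ofReal_le_iff_le_toReal (ENNReal.add_ne_top.2 ⟨hfin1, hfin2⟩)).1 h2
  exact h1.trans h3

end CVPOracle

end Regev2009

end Literature.Computability.Cryptography

end
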